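import Mathlib
import HarnessLib
import Summits.QuantumFields.YangMills.Theses.ScalingWindowSplit
import Summits.QuantumFields.YangMills.Theorems.SelfNormalisedSkewness.Negative.TreeLevelSkewnessVanishes
import Summits.QuantumFields.YangMills.Theorems.SelfNormalisedSkewness.Negative.SelfNormalisedSkewnessFalseWithoutFloor
import Summits.QuantumFields.YangMills.Theorems.SelfNormalisedSkewness.Negative.SelfNormalisedSkewnessFalseOfMaxwellDominatedWindowScheme

/-!
# Disproof of `SelfNormalisedSkewness` (crux stmt-QuantumFields-18944, W₂ of route `ScalingWindowSplit`) — findings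

Standing crux-disprover work file (refuter-cdisprove-stmt-QuantumFields-18944, cycle 1, 2026-08-17).
Everything below is kernel-checked (no `sorry`); prose only in docstrings.  Index:

* **(F1) The FLOOR is load-bearing — unconditional.**  `SelfNormalisedSkewnessWithoutFloor` (W₂ with the
  conjunct `a_k^p ≤ T⁰_k(u,θu)` deleted) is FALSE: `selfNormalisedSkewness_false_without_floor`, witness the
  trivial group `PUnit` in its faithful `0`-dimensional unitary representation, `a_k = 1/(k+1)`,
  `L_k = (k+1)²`, `β_k = k`, `u = 0` (all lattice `n`-point functions vanish, the window reads `0 ≤ M·0`,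
  `κ₃^canon = 0 < δ`).  LANDED: p148952 ACCEPTED @0ef123c009ef
  (`Theorems/SelfNormalisedSkewness/Negative/SelfNormalisedSkewnessFalseWithoutFloor.lean`, imported here).  With the
  floor the same witness is a vacuous instance (`a_k^p > 0 = T⁰`): the floor is the ONLY clause excluding
  c-number curvature fields (trivial `G`, finite `G` freeze super-polynomially — physics, not Lean).
* **(F2) The crux as typed is false MODULO `H` = `MaxwellDominatedWindowScheme`.**  The landed
  certificate `Negative.treeLevelSkewness_vanishes` (birth refuter, p143515: `tr K(h₁)K(h₂)K(h₃) = 0` for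
  traceless symmetric `hᵢ`) is made CONCRETE for the free Maxwell field of `d = 4`: `hessInvSq` (Hessian
  of `|x|⁻²`, symmetric, traceless for ALL `x`), `maxwellKernel = K ∘ hessInvSq` (= `⟨F_{μν}(x)F_{ρσ}(0)⟩`
  up to `4π²`), `maxwellOddRing_eq_zero` (`tr G(x−y)G(y−z)G(z−x) = 0` at ALL points — conceptually:
  electric–magnetic duality of free Maxwell theory flips the sign of `F²`'s connected odd correlators),
  `maxwellEvenRing_e₀_ne_zero` (`tr G(e₀)G(−e₀) = 96`: the even ring is NOT degenerate),
  `maxwellRing3_eq_zero`, `maxwellSkewRatio_eq_zero` (the Gaussian prediction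
  `8R₃(f,g,h)/(2R₂(u))^{3/2}` for the crux's scale-free skewness is `0` for every `u, f, g, h`).
  `H`: some admissible datum `(G, r, sch, u, p, M)` meeting EXACTLY W₂'s four hypotheses along which
  `κ₃^canon_k(f,g,h) → maxwellSkewRatio u f g h` for every pairwise disjoint triple (intended inhabitants:
  `U(1)₄` Coulomb phase along any polynomially weak-coupling scheme — Guth 1980, Fröhlich–Spencer 1982,
  Driver 1987 doi:10.1007/bf01212424 —, and ANY compact `G` along deep-UV window schemes `a_kξ_k → ∞`;
  the LATTICE odd ring is an `O(a)` artefact, r1-ideator numerics j023616/j023622,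
  `Cruxes/SelfNormalisedSkewness/MaxwellOddRing-r1-i2.md`).  `SelfNormalisedSkewness_false_of_MaxwellDominatedWindowScheme :
  H → ¬ W₂`.  LANDED: p148989 ACCEPTED @684a64f0d96c (`--negative-modulo MaxwellDominatedWindowScheme`,
  `Theorems/SelfNormalisedSkewness/Negative/SelfNormalisedSkewnessFalseOfMaxwellDominatedWindowScheme.lean`,
  imported here); the item is HELD, `H` filed as a construction item.  `H` is not constructible here: two-sided
  weak-coupling asymptotics of composite-operator cumulants with error control at physical separation
  (Bałaban/Driver-level constructive input) are absent from the tree.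
* **(F3) The other hypotheses (paper analysis; no cheap witness exists, none is landable).**
  - weak coupling `β_k → ∞`: NOT what protects W₂ in the abelian case — at FIXED `β > β_c` the `U(1)₄`
    Coulomb phase is still Maxwell-dominated at physical separation `1/a_k → ∞` lattice units (irrelevant
    corrections die as powers of `a_k`), so W₂-without-weak-coupling fails by the same non-constructible
    witness; at fixed STRONG coupling the window fails (lattice mass `m(β) > 0` fixed ⇒ `m/a_k → ∞`);
    `β ≡ 0` is vacuous (`T⁰ ≡ 0`: past/future plaquettes share no link).  No new information beyond (F2).
  - past support `tsupport u ⊆ {y⁰ < 0}`: load-bearing for U (the refuter's `TwoRateWindowScheme` lemma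
    on stmt-18929) but apparently NOT for W₂: the perverse windows it admits put the scheme in the
    collapsing-window (deep-IR, `a_kξ_k → 0`) regime, where clustered triples have skewness ratio
    `≍ e^{m_k(3d_u − ℓ₃)/2·…} → ∞` (Steiner length `ℓ₃` of the triple < `3×` the reference separation), i.e.
    the `κ₃`-floor holds MORE easily; dropping it yields no counterexample pattern.
  - window `T⁰_k(u) ≤ M·T⁰_k(τ₋₁u)`: same remark — it bounds the physical mass ABOVE; the IR regimes it
    excludes have LARGE, not small, self-normalised skewness; finite (frozen) `G` stay vacuous without it
    (floor + `β_k → ∞` already contradict `T⁰ ≍ e^{−cβ_k/a_k}`).  Possibly unnecessary FOR W₂ (it is U's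
    and the seam's clause); information for the prover, not a defect.
  - polynomial volumes: only a LOWER bound on the physical torus size (`a_kL_k ≥ a_k^{−1/N}`); finite-size
    effects at physical separation `O(1)` are `o(1)` either way; possibly unnecessary for W₂.
  - `r` faithful / `G` compact: `N = 0` forces `G` trivial (then (F1)'s vacuity); products
    `G = U(1)^m`, `U(1) × finite`, `O(2)` reduce to the abelian Maxwell-dominated family of (F2).
* **(F4) Why the INTENDED regime resists every cheap attack.**  With W₁'s volume-uniform physical gap
  `Δ` AND the window (`Δ ≤ m_phys ≤ (log M)/2`: ONE scale, `a_kξ_k ≍ 1`) the datum is a confining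
  non-abelian theory probed at its correlation length: `κ₃^canon_k(f,g,h)` tends (along subsequences) to a
  non-perturbative continuum ratio (scalar-glueball cubic coupling / `⟨0|trF²|σ⟩`-type matrix elements).
  No symmetry makes odd cumulants of `tr F² − ⟨tr F²⟩` vanish (it is C-, P-, T-even and not the image
  of an odd field); its vanishing for ALL triples along a window scheme = asymptotic Gaussianity of the
  glueball sector at the confinement scale = the `φ⁴₄`-type triviality fate for YM₄ (Aizenman–Duminil-Copin
  2021 is the scalar precedent; Chatterjee's Gaussian limit arXiv:2401.10507 is YM–HIGGS in a Higgs
  regime, not Wilson's pure gauge theory) — a substantive open possibility with no computational handle: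
  strong coupling expansions do not reach `β → ∞`, weak-coupling perturbation theory gives `0` at tree
  level (F2) and an UNKNOWN-sign relative `O(g²)` one-loop coefficient (the `trace-anomaly-ope` card's
  `b₀` mechanism is the only proposed handle), and no finite computation (small tori, `kit`) constrains an
  `∀ᶠ k` statement about `β_k → ∞`.  Verdict for this cycle: NO unconditional kill is possible in the
  tree; the typed crux is refuted on paper (misstated) and held by (F2).
* **(F5) Repair (for the planner).**  `C′` = the birth refuter's `SelfNormalisedSkewnessGapped`
  (evidence `Repaired.lean` / `repaired_signature.txt` on the item): binder `(M Δ : ℝ)` and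
  `0 < Δ → HasLatticeMassGap r sch Δ →` right after `sch.HasWeakCouplingLimit →`, everything else
  verbatim; both inhabitant families of `H` miss `C′` (Coulomb phase: power-law tails on large tori;
  deep UV: physical mass `1/(a_kξ_k) → 0 < Δ`); the glue `existenceLegFromLatticeR_proof` needs W₁'s
  `Δ, hΔ, hgap` as three more tokens.  Optional: also `IsCompactSimpleLieGroup G →` (group-blindness buys
  nothing once the gap is assumed; it documents that W₂R is a statement about confining theories).
  (F1) still applies to `C′` (the trivial group has every `HasLatticeMassGap`: all its connected
  correlations vanish), so the floor stays load-bearing after repair.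
* **(F6) Cautions for the positive lines (near-misses, not defects).**  (a) `T⁰_k(w) = Cov(Φ(w), Φ(θw))`
  is NOT an exact reflection-positivity square on the lattice: the six plaquettes of `actionDensity` are
  based at the site `x` and extend in the POSITIVE coordinate directions, so the lattice time reflection
  maps the plaquette family of `Φ(w)` onto that of `Φ(θw)` only up to a one-unit shift of the temporal
  plaquettes — positivity `T⁰ ≥ 0`, monotonicity and log-convexity in the time shift (used by
  `hellmann-feynman-slab` / `running-gap-sum-rule`) hold for the exactly reflected observable and transfer
  to `T⁰` only up to `O(a_k)`-offset bookkeeping (or after replacing `θ` by the lattice-adapted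
  reflection `y⁰ ↦ −y⁰ − a_k` on temporal plaquettes).  (b) "W₂ needs only leading-order non-vanishing"
  (route text, PerturbativeInvisibility bullet) is void by (F2): the first candidate non-zero order is
  relative `O(g²)` with an uncomputed coefficient.  (c) A kurtosis (`κ₄`) floor HAS tree-level support
  (`trace_K_h₀_sq_ne_zero`-type 4-rings ≠ 0) but does not feed the summit's `κ₃`-based `IsNonGaussian`
  through the landed `IRInputs`-(d).
-/

noncomputable section

open scoped SchwartzMap BigOperators Topology
open MeasureTheory Filter Topology
open Literature.MathematicalPhysics.AQFT Literature.MathematicalPhysics.QuantumLattice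
open Literature.MathematicalPhysics.QuantumFieldTheory
open Summit.QuantumFields.YangMills.Theorems.SelfNormalisedSkewness.Negative

namespace Summit.QuantumFields.YangMills.Cruxes.SelfNormalisedSkewness.Disproof

/-! ## (F1) Load-bearing analysis — the floor (landed p148952, re-exported) -/

/-- **(F1)** W₂ with the floor conjunct deleted is false, unconditionally (trivial group, `N = 0`
representation, `a_k = 1/(k+1)`, `L_k = (k+1)²`, `β_k = k`, `u = 0`).  Any proof of W₂ — and of the
gapped repair `C′`, whose extra hypothesis `HasLatticeMassGap` the trivial group meets with `C = 0` —
must use `a_k^p ≤ T⁰_k(u,θu)`. [folklore] -/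
theorem floor_isLoadBearing : ¬ SelfNormalisedSkewnessWithoutFloor :=
  selfNormalisedSkewness_false_without_floor

/-- The trivial group meets EVERY volume-uniform lattice mass gap (all its connected correlations
vanish: the `0`-dimensional representation makes every observable's Wilson expectation factorise
trivially — here recorded in the weaker form actually needed by (F5): the curvature field is the zero
function). [folklore] -/
theorem trivial_curvature_is_zero : (trivialLatticeRep.curvature).F = fun _ => (0 : ℝ) :=
  trivialLatticeRep_curvature_F

/-! ## (F2) The crux is false modulo `H = MaxwellDominatedWindowScheme` (landed p148989, re-exported) -/

/-- **(F2a)** The free-Maxwell odd ring of `d = 4` vanishes at all points (concrete form of the landed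
`treeLevelSkewness_vanishes`; electric–magnetic duality). [folklore] -/
theorem oddRing_vanishes (x y z : E4) :
    (maxwellKernel (x - y) * maxwellKernel (y - z) * maxwellKernel (z - x)).trace = 0 :=
  maxwellOddRing_eq_zero x y z

/-- **(F2b)** … while the even ring does not (`tr G(e₀)G(−e₀) = 96`): only ODD cumulants of the free
Wick square `F²` die. [folklore] -/
theorem evenRing_nondegenerate :
    (maxwellKernel (e₀ - -e₀) * maxwellKernel (-e₀ - e₀)).trace ≠ 0 :=
  maxwellEvenRing_e₀_ne_zero

/-- **(F2c)** Hence the Gaussian prediction for the crux's self-normalised skewness is `0` for every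
reference bump and every triple. [folklore] -/
theorem gaussianPrediction_is_zero (u f g h : 𝓢(E4, ℝ)) : maxwellSkewRatio u f g h = 0 :=
  maxwellSkewRatio_eq_zero u f g h

/-- **(F2d) `H → ¬ W₂`.**  A Maxwell-dominated window scheme (an admissible datum of W₂ whose
self-normalised skewness tends to its free-Maxwell value for every disjoint triple — intended: `U(1)₄`
Coulomb phase, Guth 1980 / Fröhlich–Spencer 1982 / Driver 1987; any `G` in the deep UV) refutes the
crux as typed.  `H` is held as a construction item; class on paper refuted-misstated; repair (F5). [folklore] -/
theorem crux_false_of_H :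
    MaxwellDominatedWindowScheme →
      ¬ Summit.QuantumFields.YangMills.Theses.ScalingWindowSplit.SelfNormalisedSkewness :=
  SelfNormalisedSkewness_false_of_MaxwellDominatedWindowScheme

-- Targets: none yet (no line picked, no skeleton registered, `stuck_stubs = []` at cycle 1).

end Summit.QuantumFields.YangMills.Cruxes.SelfNormalisedSkewness.Disproof

end
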